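import Literature.NumberTheory.LFunctions.TrilinearKloostermanFractionsDiagCount
import HarnessLib

/-!
# Trilinear forms with Kloosterman fractions: the inner sum of the diagonal bound (Bettin–Chandee §3, (3.3)–(3.5))

Topic `NumberTheory/LFunctions`.  S. Bettin, V. Chandee, *Trilinear forms with Kloosterman
fractions*, Adv. Math. 328 (2018), §3: after symmetrization, the diagonal `𝒟_b` is bounded by
"`∑_{n₁} |β_{n₁} ν_{a₁}|² ∑_{ℓ₁,ℓ₂ ∈ 𝓛, ℓ₂ ∣ ℓ₁n₁} ∑_{1≤a₂≤2A} |∑_{m} e(ϑ(a₁ℓ₁−a₂ℓ₂)m̄/(bℓ₁n₁))|`",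
the `m`-sum being `≪ (bLN)^{1/2+ε} + (a₁ℓ₁−a₂ℓ₂, bn₁ℓ₁)M^{1+ε}/(bLN)` for `a₁ℓ₁ ≠ a₂ℓ₂` ((3.3)) and
trivially `≪ M` otherwise, and the gcd sum (3.4) gives (3.5):
`𝒟_b ≪ ‖β‖²‖ν‖² L (A(bLN)^{1/2} + AM/(bN) + M) M^ε`.
This file PROVES the bound for the INNER sum over `(ℓ₂, a₂)` for a fixed `(ℓ₁, n₁, a₁)`, with the
explicit per-term bound `B` of `TrilinearKloostermanFractionsDiagTerm.lean` (`BC_diag_msum_le`,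
`BC_diag_msum_le'`; general `A`, twisted, uniform in the amplifier length `L`):

* `BC_card_divisors_prime_mul_le` — `τ(ℓm) ≤ 2τ(m)` for a prime `ℓ`;
* `BC_card_amp_dvd_le` — `#{ℓ₂ ∈ 𝓛 : ℓ₂ ∣ ℓ₁n₁} ≤ 1 + τ(n₁)`;
* `BC_diag_qred_le` — for `ℓ₂ ∈ 𝓛`, `ℓ₂ ∣ ℓ₁n₁`, `c = a₁ℓ₁ − a₂ℓ₂ ≠ 0`: `q/(c,q) ≤ 8bN'²`
  (`q = bℓ₁n₁`; either `ℓ₁ ∣ c`, or `ℓ₂ ≠ ℓ₁` divides `n₁ ≤ 2N'` so that `L < 2N'`);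
* **`BC_diag_inner_le`** — `∑_{ℓ₂ ∈ 𝓛, ℓ₂ ∣ ℓ₁n₁} ∑_{a₂ ≤ 2A} B ≤ (1+τ(n₁)) (2M + τ(bn₁)² Tw (32(2M+1)A/(bN') + 16A√(bLN')(1+log(8bN'²))))`,
  `Tw = 1 + 8π|η|A/(bN'M)`.

No new named facts (D-0026).

## References

* S. Bettin, V. Chandee, Adv. Math. 328 (2018) 1234–1262 (arXiv:1502.00769), §3 ((3.3)–(3.5)).
  [BettinChandee2018]
-/

noncomputable section

open Finset Real

namespace Literature.NumberTheory.LFunctions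

/-- `τ(ℓ m) ≤ 2 τ(m)` for a prime `ℓ` and `m ≥ 1` (every divisor of `ℓm` is `d` or `ℓd` with
`d ∣ m`). [folklore] -/
theorem BC_card_divisors_prime_mul_le {ℓ : ℕ} (hℓ : ℓ.Prime) {m : ℕ} (hm : 0 < m) :
    (Nat.divisors (ℓ * m)).card ≤ 2 * (Nat.divisors m).card := by
  classical
  have hsub : Nat.divisors (ℓ * m) ⊆ Nat.divisors m ∪ (Nat.divisors m).image (fun d => ℓ * d) := by
    intro d hd
    rw [Nat.mem_divisors] at hd
    obtain ⟨hdvd, _⟩ := hd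
    rw [Finset.mem_union, Finset.mem_image]
    by_cases hℓd : ℓ ∣ d
    · right
      obtain ⟨d', rfl⟩ := hℓd
      refine ⟨d', ?_, rfl⟩
      rw [Nat.mem_divisors]
      exact ⟨(Nat.mul_dvd_mul_iff_left hℓ.pos).mp hdvd, hm.ne'⟩
    · left
      rw [Nat.mem_divisors]
      exact ⟨Nat.Coprime.dvd_of_dvd_mul_left ((Nat.Prime.coprime_iff_not_dvd hℓ).mpr hℓd).symm hdvd,
        hm.ne'⟩
  calc (Nat.divisors (ℓ * m)).card ≤ (Nat.divisors m ∪ (Nat.divisors m).image (fun d => ℓ * d)).card :=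
        Finset.card_le_card hsub
    _ ≤ (Nat.divisors m).card + ((Nat.divisors m).image (fun d => ℓ * d)).card :=
        Finset.card_union_le _ _
    _ ≤ (Nat.divisors m).card + (Nat.divisors m).card :=
        Nat.add_le_add_left Finset.card_image_le _
    _ = 2 * (Nat.divisors m).card := by ring

/-- `#{ℓ₂ ∈ 𝓛 : ℓ₂ ∣ ℓ₁ n₁} ≤ 1 + τ(n₁)` when the members of `𝓛` are primes, `ℓ₁` is prime and
`n₁ ≥ 1` (such an `ℓ₂` is `ℓ₁` or a divisor of `n₁`). [folklore] -/
theorem BC_card_amp_dvd_le (S : Finset ℕ) (hS : ∀ ℓ ∈ S, ℓ.Prime) {ℓ₁ n₁ : ℕ} (hℓ₁ : ℓ₁.Prime)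
    (hn₁ : 0 < n₁) :
    (S.filter (fun ℓ₂ => ℓ₂ ∣ ℓ₁ * n₁)).card ≤ 1 + (Nat.divisors n₁).card := by
  classical
  have hsub : S.filter (fun ℓ₂ => ℓ₂ ∣ ℓ₁ * n₁) ⊆ insert ℓ₁ (Nat.divisors n₁) := by
    intro ℓ₂ hℓ₂
    rw [Finset.mem_filter] at hℓ₂
    obtain ⟨hmem, hdvd⟩ := hℓ₂
    have hp := hS ℓ₂ hmem
    rw [Finset.mem_insert, Nat.mem_divisors]
    rcases (Nat.Prime.dvd_mul hp).mp hdvd with h | h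
    · left; exact ((Nat.prime_dvd_prime_iff_eq hp hℓ₁).mp h)
    · right; exact ⟨h, hn₁.ne'⟩
  calc (S.filter (fun ℓ₂ => ℓ₂ ∣ ℓ₁ * n₁)).card ≤ (insert ℓ₁ (Nat.divisors n₁)).card :=
        Finset.card_le_card hsub
    _ ≤ (Nat.divisors n₁).card + 1 := Finset.card_insert_le _ _
    _ = 1 + (Nat.divisors n₁).card := by ring

/-- **The reduced modulus is small**: for `ℓ₁, ℓ₂` primes with `ℓ₁ ≤ 2L < 2ℓ₂`, `ℓ₂ ∣ ℓ₁n₁`,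
`1 ≤ n₁ ≤ 2N'` and `c = a₁ℓ₁ − a₂ℓ₂ ≠ 0`, with `q = bℓ₁n₁`: `q/(c,q) ≤ 8bN'²` (if `ℓ₁ ∣ c` then
`q/(c,q) ≤ q/ℓ₁ = bn₁`; otherwise `ℓ₂ ≠ ℓ₁`, so `ℓ₂ ∣ n₁` and `L < 2N'`). [folklore] -/
theorem BC_diag_qred_le {b ℓ₁ n₁ ℓ₂ a₁ a₂ L : ℕ} {N' : ℝ} (hb : 0 < b) (hℓ₁p : ℓ₁.Prime)
    (hℓ₂p : ℓ₂.Prime) (hℓ₁L : ℓ₁ ≤ 2 * L) (hℓ₂L : L < ℓ₂) (hn₁ : 0 < n₁) (hn₁N : (n₁ : ℝ) ≤ 2 * N')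
    (hdvd : ℓ₂ ∣ ℓ₁ * n₁) (hc : (((a₁ * ℓ₁ : ℕ) : ℤ) - ((a₂ * ℓ₂ : ℕ) : ℤ)) ≠ 0) :
    ((((b * (ℓ₁ * n₁)) / Int.gcd (((a₁ * ℓ₁ : ℕ) : ℤ) - ((a₂ * ℓ₂ : ℕ) : ℤ)) (((b * (ℓ₁ * n₁)) : ℕ) : ℤ)) : ℕ) : ℝ) ≤ 8 * (b : ℝ) * N' ^ 2 := by
  have hq0 : 0 < (b * (ℓ₁ * n₁)) := Nat.mul_pos hb (Nat.mul_pos hℓ₁p.pos hn₁)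
  have hN' : (1 : ℝ) / 2 ≤ N' := by
    have : (1 : ℝ) ≤ n₁ := by exact_mod_cast hn₁
    linarith
  have hbr : (1 : ℝ) ≤ b := by exact_mod_cast hb
  set g : ℕ := Int.gcd (((a₁ * ℓ₁ : ℕ) : ℤ) - ((a₂ * ℓ₂ : ℕ) : ℤ)) (((b * (ℓ₁ * n₁)) : ℕ) : ℤ) with hg
  have hg0 : 0 < g := by rw [hg]; exact Int.gcd_pos_of_ne_zero_left _ hc
  by_cases hdiv : (ℓ₁ : ℤ) ∣ (((a₁ * ℓ₁ : ℕ) : ℤ) - ((a₂ * ℓ₂ : ℕ) : ℤ))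
  · -- `ℓ₁ ∣ g`, so `q/g ≤ q/ℓ₁ = b n₁ ≤ 2bN' ≤ 8bN'²`
    have hℓ₁g : ℓ₁ ∣ g := by
      rw [hg, Int.gcd_eq_natAbs, Int.natAbs_natCast]
      refine Nat.dvd_gcd ?_ ⟨b * n₁, by ring⟩
      have := Int.natAbs_dvd_natAbs.mpr hdiv
      simpa using this
    have h1 : (b * (ℓ₁ * n₁)) / g ≤ (b * (ℓ₁ * n₁)) / ℓ₁ :=
      Nat.div_le_div_left (Nat.le_of_dvd hg0 hℓ₁g) hℓ₁p.pos
    have h2 : (b * (ℓ₁ * n₁)) / ℓ₁ = b * n₁ := by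
      rw [show b * (ℓ₁ * n₁) = ℓ₁ * (b * n₁) by ring, Nat.mul_div_cancel_left _ hℓ₁p.pos]
    rw [h2] at h1
    calc (((b * (ℓ₁ * n₁)) / g : ℕ) : ℝ) ≤ ((b * n₁ : ℕ) : ℝ) := by exact_mod_cast h1
      _ = (b : ℝ) * n₁ := by push_cast; ring
      _ ≤ (b : ℝ) * (2 * N') := by gcongr
      _ ≤ (b : ℝ) * (8 * N' ^ 2) := by
          apply mul_le_mul_of_nonneg_left _ (by positivity)
          nlinarith
      _ = 8 * (b : ℝ) * N' ^ 2 := by ring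
  · -- `ℓ₂ ≠ ℓ₁`, so `ℓ₂ ∣ n₁`, `L < ℓ₂ ≤ n₁ ≤ 2N'`, and `q/g ≤ q ≤ b (2L)(2N') ≤ 8bN'²`
    have hne : ℓ₂ ≠ ℓ₁ := by
      rintro rfl
      apply hdiv
      refine ⟨(a₁ : ℤ) - a₂, ?_⟩
      push_cast; ring
    have hℓ₂n₁ : ℓ₂ ∣ n₁ := by
      rcases (Nat.Prime.dvd_mul hℓ₂p).mp hdvd with h | h
      · exact absurd ((Nat.prime_dvd_prime_iff_eq hℓ₂p hℓ₁p).mp h) hne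
      · exact h
    have hℓ₂le : ℓ₂ ≤ n₁ := Nat.le_of_dvd hn₁ hℓ₂n₁
    have hLn : L < n₁ := lt_of_lt_of_le hℓ₂L hℓ₂le
    have h1 : (b * (ℓ₁ * n₁)) / g ≤ (b * (ℓ₁ * n₁)) := Nat.div_le_self _ _
    have hℓ₁r : (ℓ₁ : ℝ) ≤ 2 * L := by exact_mod_cast hℓ₁L
    have hLr : (L : ℝ) ≤ n₁ := by exact_mod_cast hLn.le
    have hn₁r : (0 : ℝ) ≤ n₁ := Nat.cast_nonneg _
    calc (((b * (ℓ₁ * n₁)) / g : ℕ) : ℝ) ≤ (((b * (ℓ₁ * n₁)) : ℕ) : ℝ) := by exact_mod_cast h1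
      _ = (b : ℝ) * (ℓ₁ * n₁) := by push_cast; ring
      _ ≤ (b : ℝ) * (2 * n₁ * n₁) := by
          apply mul_le_mul_of_nonneg_left _ (by positivity)
          nlinarith
      _ ≤ (b : ℝ) * (2 * (2 * N') * (2 * N')) := by
          apply mul_le_mul_of_nonneg_left _ (by positivity)
          nlinarith
      _ = 8 * (b : ℝ) * N' ^ 2 := by ring

/-- **The gcd sum (3.4) over `a₂`**: for `q = bℓ₁n₁ ≥ 1`, `ℓ₁, ℓ₂ ≤ 2L`, `ℓ₂ ≥ 1`, `a₁ ≤ ⌊2A⌋`,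
`∑_{1 ≤ a₂ ≤ 2A, c ≠ 0} (c, q) ≤ 2τ(q)(2L⌊2A⌋)` (`c = a₁ℓ₁ − a₂ℓ₂`; `BC_sum_gcd_image_le`).
[cite: BettinChandee2018, §3 (3.4)] -/
theorem BC_diag_gcd_sum_le {b ℓ₁ n₁ a₁ ℓ₂ L : ℕ} {A : ℝ} (hq : 0 < (b * (ℓ₁ * n₁))) (hℓ₁L : ℓ₁ ≤ 2 * L)
    (hℓ₂L : ℓ₂ ≤ 2 * L) (hℓ₂ : 0 < ℓ₂) (ha₁ : a₁ ≤ ⌊2 * A⌋₊) :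
    ∑ a₂ ∈ (Icc 1 ⌊2 * A⌋₊).filter (fun a₂ => (((a₁ * ℓ₁ : ℕ) : ℤ) - ((a₂ * ℓ₂ : ℕ) : ℤ)) ≠ 0),
        (Int.gcd (((a₁ * ℓ₁ : ℕ) : ℤ) - ((a₂ * ℓ₂ : ℕ) : ℤ)) (((b * (ℓ₁ * n₁)) : ℕ) : ℤ) : ℝ) ≤
      2 * (Nat.divisors (b * (ℓ₁ * n₁))).card * ((2 * L * ⌊2 * A⌋₊ : ℕ) : ℝ) := by
  refine BC_sum_gcd_image_le hq (2 * L * ⌊2 * A⌋₊) _ (fun a₂ => (((a₁ * ℓ₁ : ℕ) : ℤ) - ((a₂ * ℓ₂ : ℕ) : ℤ))) ?_ ?_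
  · intro a ha a' ha' h
    have h' : ((a * ℓ₂ : ℕ) : ℤ) = ((a' * ℓ₂ : ℕ) : ℤ) := by
      have := h; simp only at this; linarith
    have h'' : a * ℓ₂ = a' * ℓ₂ := by exact_mod_cast h'
    exact Nat.eq_of_mul_eq_mul_right hℓ₂ h''
  · intro a ha
    rw [Finset.mem_filter, Finset.mem_Icc] at ha
    obtain ⟨⟨_, ha2⟩, hne⟩ := ha
    refine ⟨hne, ?_⟩
    have h1 : a₁ * ℓ₁ ≤ 2 * L * ⌊2 * A⌋₊ := by
      calc a₁ * ℓ₁ ≤ ⌊2 * A⌋₊ * (2 * L) := Nat.mul_le_mul ha₁ hℓ₁L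
        _ = 2 * L * ⌊2 * A⌋₊ := by ring
    have h2 : a * ℓ₂ ≤ 2 * L * ⌊2 * A⌋₊ := by
      calc a * ℓ₂ ≤ ⌊2 * A⌋₊ * (2 * L) := Nat.mul_le_mul ha2 hℓ₂L
        _ = 2 * L * ⌊2 * A⌋₊ := by ring
    rw [abs_le]
    constructor
    · have : (((a * ℓ₂ : ℕ) : ℤ)) ≤ ((2 * L * ⌊2 * A⌋₊ : ℕ) : ℤ) := by exact_mod_cast h2
      have h0 : (0 : ℤ) ≤ ((a₁ * ℓ₁ : ℕ) : ℤ) := by positivity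
      linarith
    · have : (((a₁ * ℓ₁ : ℕ) : ℤ)) ≤ ((2 * L * ⌊2 * A⌋₊ : ℕ) : ℤ) := by exact_mod_cast h1
      have h0 : (0 : ℤ) ≤ ((a * ℓ₂ : ℕ) : ℤ) := by positivity
      linarith

/-- At most one `a₂` has `a₂ℓ₂ = a₁ℓ₁` (`ℓ₂ ≥ 1`). [folklore] -/
theorem BC_diag_card_czero_le {ℓ₁ a₁ ℓ₂ : ℕ} (hℓ₂ : 0 < ℓ₂) (S : Finset ℕ) :
    (S.filter (fun a₂ => (((a₁ * ℓ₁ : ℕ) : ℤ) - ((a₂ * ℓ₂ : ℕ) : ℤ)) = 0)).card ≤ 1 := by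
  refine Finset.card_le_one.mpr fun a ha a' ha' => ?_
  rw [Finset.mem_filter] at ha ha'
  have h1 : ((a * ℓ₂ : ℕ) : ℤ) = ((a₁ * ℓ₁ : ℕ) : ℤ) := by linarith [ha.2]
  have h2 : ((a' * ℓ₂ : ℕ) : ℤ) = ((a₁ * ℓ₁ : ℕ) : ℤ) := by linarith [ha'.2]
  have h3 : a * ℓ₂ = a' * ℓ₂ := by exact_mod_cast h1.trans h2.symm
  exact Nat.eq_of_mul_eq_mul_right hℓ₂ h3

set_option maxHeartbeats 4000000 in
/-- **The inner sum of the diagonal bound** (Bettin–Chandee §3, from (3.3) to (3.5), general `A`,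
twisted, uniform in `L`): for `ℓ₁ ∈ 𝓛` (primes in `(L, 2L]` coprime to `bϑ`), `N' < n₁ ≤ 2N'`,
`1 ≤ a₁ ≤ 2A`, `M, A ≥ 1/2`, `L ≥ 1`, the sum over `ℓ₂ ∈ 𝓛` with `ℓ₂ ∣ ℓ₁n₁` and `1 ≤ a₂ ≤ 2A` of the
per-term bound `B` of `BC_diag_msum_le`/`BC_diag_msum_le'` (`2M` if `a₁ℓ₁ = a₂ℓ₂`, else
`τ(q)((2M+1)(c,q)/q + τ(q')√q'(1+log q'))(1 + 2π(|η||c|/q)/M)`, `q = bℓ₁n₁`, `c = a₁ℓ₁ − a₂ℓ₂`,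
`q' = q/(c,q)`) is at most
`(1+τ(n₁)) (2M + τ(bn₁)² Tw (32(2M+1)A/(bN') + 16A√(bLN')(1+log(8bN'²))))`,
`Tw = 1 + 2π(|η|(4A/(bN')))/M`. [cite: BettinChandee2018, §3 (3.3)–(3.5)] -/
theorem BC_diag_inner_le {b ℓ₁ n₁ a₁ L : ℕ} {M N' A : ℝ} (ϑ : ℤ) (η : ℝ) (hb : 0 < b)
    (hL : 1 ≤ L) (hM : 1 / 2 ≤ M) (hA : 1 / 2 ≤ A) (hN' : 0 < N')
    (hℓ₁ : ℓ₁ ∈ ((Ioc L (2 * L)).filter (fun ℓ => ℓ.Prime ∧ ℓ.Coprime b ∧ ℓ.Coprime ϑ.natAbs))) (hn₁ : N' < (n₁ : ℝ)) (hn₁N : (n₁ : ℝ) ≤ 2 * N')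
    (ha₁ : a₁ ∈ Icc 1 ⌊2 * A⌋₊) :
    ∑ ℓ₂ ∈ ((Ioc L (2 * L)).filter (fun ℓ => ℓ.Prime ∧ ℓ.Coprime b ∧ ℓ.Coprime ϑ.natAbs)).filter (fun ℓ₂ => ℓ₂ ∣ ℓ₁ * n₁),
          ∑ a₂ ∈ Icc 1 ⌊2 * A⌋₊,
          (if (((a₁ * ℓ₁ : ℕ) : ℤ) - ((a₂ * ℓ₂ : ℕ) : ℤ)) = 0 then 2 * M else
            ((Nat.divisors (b * (ℓ₁ * n₁))).card : ℝ) *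
              ((2 * M + 1) * (Int.gcd (((a₁ * ℓ₁ : ℕ) : ℤ) - ((a₂ * ℓ₂ : ℕ) : ℤ)) (((b * (ℓ₁ * n₁)) : ℕ) : ℤ) : ℝ) / (((b * (ℓ₁ * n₁)) : ℕ) : ℝ) +
                ((Nat.divisors ((b * (ℓ₁ * n₁)) / Int.gcd (((a₁ * ℓ₁ : ℕ) : ℤ) - ((a₂ * ℓ₂ : ℕ) : ℤ)) (((b * (ℓ₁ * n₁)) : ℕ) : ℤ))).card : ℝ) * Real.sqrt ((((b * (ℓ₁ * n₁)) / Int.gcd (((a₁ * ℓ₁ : ℕ) : ℤ) - ((a₂ * ℓ₂ : ℕ) : ℤ)) (((b * (ℓ₁ * n₁)) : ℕ) : ℤ)) : ℕ) : ℝ) *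
                  (1 + Real.log ((((b * (ℓ₁ * n₁)) / Int.gcd (((a₁ * ℓ₁ : ℕ) : ℤ) - ((a₂ * ℓ₂ : ℕ) : ℤ)) (((b * (ℓ₁ * n₁)) : ℕ) : ℤ)) : ℕ) : ℝ))) *
              (1 + 2 * Real.pi * (|η| * |((((a₁ * ℓ₁ : ℕ) : ℤ) - ((a₂ * ℓ₂ : ℕ) : ℤ)) : ℝ)| / (((b * (ℓ₁ * n₁)) : ℕ) : ℝ)) / M)) ≤
      (1 + ((Nat.divisors n₁).card : ℝ)) *
          (2 * M + ((Nat.divisors (b * n₁)).card : ℝ) ^ 2 * (1 + 2 * Real.pi * (|η| * (4 * A / ((b : ℝ) * N'))) / M) *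
            (32 * (2 * M + 1) * A / ((b : ℝ) * N') +
              16 * A * Real.sqrt ((b : ℝ) * (L : ℝ) * N') * (1 + Real.log (8 * (b : ℝ) * N' ^ 2)))) := by
  classical
  obtain ⟨hℓ₁I, hℓ₁p, -, -⟩ := Finset.mem_filter.mp hℓ₁
  obtain ⟨hLℓ₁, hℓ₁L⟩ := Finset.mem_Ioc.mp hℓ₁I
  have ha₁' : a₁ ≤ ⌊2 * A⌋₊ := (Finset.mem_Icc.mp ha₁).2
  have hn₁pos : 0 < n₁ := by
    have : (0 : ℝ) < n₁ := hN'.trans hn₁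
    exact_mod_cast this
  have hq0 : 0 < (b * (ℓ₁ * n₁)) := Nat.mul_pos hb (Nat.mul_pos hℓ₁p.pos hn₁pos)
  have hM0 : 0 < M := by linarith
  have hA0 : 0 < A := by linarith
  have hbr : (0 : ℝ) < b := by exact_mod_cast hb
  have hLr : (1 : ℝ) ≤ L := by exact_mod_cast hL
  have hℓ₁r : (L : ℝ) < ℓ₁ := by exact_mod_cast hLℓ₁
  have hℓ₁r' : (ℓ₁ : ℝ) ≤ 2 * L := by exact_mod_cast hℓ₁L
  have hfloorA : ((⌊2 * A⌋₊ : ℕ) : ℝ) ≤ 2 * A := Nat.floor_le (by linarith)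
  -- `q` as a real number, `bLN' < q ≤ 4bLN'`
  have hqR : ((((b * (ℓ₁ * n₁))) : ℕ) : ℝ) = (b : ℝ) * ((ℓ₁ : ℝ) * n₁) := by push_cast; ring
  have hq_lb : (b : ℝ) * L * N' < ((((b * (ℓ₁ * n₁))) : ℕ) : ℝ) := by
    rw [hqR]
    have h1 : (L : ℝ) * N' < ℓ₁ * n₁ := by
      calc (L : ℝ) * N' < ℓ₁ * N' := by
            exact mul_lt_mul_of_pos_right hℓ₁r hN'
        _ ≤ ℓ₁ * n₁ := by
            exact mul_le_mul_of_nonneg_left hn₁.le (by positivity)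
    nlinarith
  have hq_ub : ((((b * (ℓ₁ * n₁))) : ℕ) : ℝ) ≤ 4 * ((b : ℝ) * L * N') := by
    rw [hqR]
    have h1 : (ℓ₁ : ℝ) * n₁ ≤ (2 * L) * (2 * N') :=
      mul_le_mul hℓ₁r' hn₁N (by positivity) (by positivity)
    nlinarith
  have hbLN : (0 : ℝ) < (b : ℝ) * L * N' := by positivity
  have hqpos : (0 : ℝ) < ((((b * (ℓ₁ * n₁))) : ℕ) : ℝ) := by exact_mod_cast hq0
  -- `τ(q) ≤ 2 τ(b n₁)`
  have hτq : ((Nat.divisors (b * (ℓ₁ * n₁))).card : ℝ) ≤ 2 * (Nat.divisors (b * n₁)).card := by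
    have h := BC_card_divisors_prime_mul_le hℓ₁p (Nat.mul_pos hb hn₁pos)
    rw [show ℓ₁ * (b * n₁) = (b * (ℓ₁ * n₁)) by ring] at h
    exact_mod_cast h
  -- abbreviations
  set τ₀ : ℝ := ((Nat.divisors (b * n₁)).card : ℝ) with hτ₀
  have hτ₀1 : 1 ≤ τ₀ := by
    rw [hτ₀]
    have : 0 < (Nat.divisors (b * n₁)).card :=
      Finset.card_pos.mpr ⟨1, Nat.one_mem_divisors.mpr (Nat.mul_pos hb hn₁pos).ne'⟩
    exact_mod_cast this
  set Tw : ℝ := (1 + 2 * Real.pi * (|η| * (4 * A / ((b : ℝ) * N'))) / M) with hTw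
  have hTw1 : 1 ≤ Tw := by
    rw [hTw]
    have : 0 ≤ 2 * Real.pi * (|η| * (4 * A / ((b : ℝ) * N'))) / M := by positivity
    linarith
  set Lg : ℝ := 1 + Real.log (8 * (b : ℝ) * N' ^ 2) with hLg
  have hLg0 : 0 ≤ Lg := by
    rw [hLg]
    have h8 : (1 : ℝ) ≤ 8 * (b : ℝ) * N' ^ 2 := by
      have hb1 : (1 : ℝ) ≤ b := by exact_mod_cast hb
      have hN'h : (1 : ℝ) / 2 ≤ N' := by
        have : (1 : ℝ) ≤ n₁ := by exact_mod_cast hn₁pos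
        linarith
      nlinarith
    have := Real.log_nonneg h8
    linarith
  set SQ : ℝ := Real.sqrt ((b : ℝ) * (L : ℝ) * N') with hSQ
  have hSQ0 : 0 ≤ SQ := Real.sqrt_nonneg _
  -- the bound for each `ℓ₂`
  set I₀ : ℝ := 2 * M + τ₀ ^ 2 * Tw *
      (32 * (2 * M + 1) * A / ((b : ℝ) * N') + 16 * A * SQ * Lg) with hI₀
  have hI₀0 : 0 ≤ I₀ := by rw [hI₀]; positivity
  have hper : ∀ ℓ₂ ∈ ((Ioc L (2 * L)).filter (fun ℓ => ℓ.Prime ∧ ℓ.Coprime b ∧ ℓ.Coprime ϑ.natAbs)).filter (fun ℓ₂ => ℓ₂ ∣ ℓ₁ * n₁),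
      ∑ a₂ ∈ Icc 1 ⌊2 * A⌋₊,
          (if (((a₁ * ℓ₁ : ℕ) : ℤ) - ((a₂ * ℓ₂ : ℕ) : ℤ)) = 0 then 2 * M else
            ((Nat.divisors (b * (ℓ₁ * n₁))).card : ℝ) *
              ((2 * M + 1) * (Int.gcd (((a₁ * ℓ₁ : ℕ) : ℤ) - ((a₂ * ℓ₂ : ℕ) : ℤ)) (((b * (ℓ₁ * n₁)) : ℕ) : ℤ) : ℝ) / (((b * (ℓ₁ * n₁)) : ℕ) : ℝ) +
                ((Nat.divisors ((b * (ℓ₁ * n₁)) / Int.gcd (((a₁ * ℓ₁ : ℕ) : ℤ) - ((a₂ * ℓ₂ : ℕ) : ℤ)) (((b * (ℓ₁ * n₁)) : ℕ) : ℤ))).card : ℝ) * Real.sqrt ((((b * (ℓ₁ * n₁)) / Int.gcd (((a₁ * ℓ₁ : ℕ) : ℤ) - ((a₂ * ℓ₂ : ℕ) : ℤ)) (((b * (ℓ₁ * n₁)) : ℕ) : ℤ)) : ℕ) : ℝ) *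
                  (1 + Real.log ((((b * (ℓ₁ * n₁)) / Int.gcd (((a₁ * ℓ₁ : ℕ) : ℤ) - ((a₂ * ℓ₂ : ℕ) : ℤ)) (((b * (ℓ₁ * n₁)) : ℕ) : ℤ)) : ℕ) : ℝ))) *
              (1 + 2 * Real.pi * (|η| * |((((a₁ * ℓ₁ : ℕ) : ℤ) - ((a₂ * ℓ₂ : ℕ) : ℤ)) : ℝ)| / (((b * (ℓ₁ * n₁)) : ℕ) : ℝ)) / M)) ≤ I₀ := by
    intro ℓ₂ hℓ₂
    obtain ⟨hℓ₂mem, hℓ₂dvd⟩ := Finset.mem_filter.mp hℓ₂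
    obtain ⟨hℓ₂I, hℓ₂p, -, -⟩ := Finset.mem_filter.mp hℓ₂mem
    obtain ⟨hLℓ₂, hℓ₂L⟩ := Finset.mem_Ioc.mp hℓ₂I
    have hℓ₂pos : 0 < ℓ₂ := hℓ₂p.pos
    have hℓ₂r' : (ℓ₂ : ℝ) ≤ 2 * L := by exact_mod_cast hℓ₂L
    rw [← Finset.sum_filter_add_sum_filter_not (Icc 1 ⌊2 * A⌋₊)
      (fun a₂ => (((a₁ * ℓ₁ : ℕ) : ℤ) - ((a₂ * ℓ₂ : ℕ) : ℤ)) = 0)]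
    -- the terms with `c = 0`
    have hzero : ∑ a₂ ∈ (Icc 1 ⌊2 * A⌋₊).filter (fun a₂ => (((a₁ * ℓ₁ : ℕ) : ℤ) - ((a₂ * ℓ₂ : ℕ) : ℤ)) = 0),
        (if (((a₁ * ℓ₁ : ℕ) : ℤ) - ((a₂ * ℓ₂ : ℕ) : ℤ)) = 0 then 2 * M else
            ((Nat.divisors (b * (ℓ₁ * n₁))).card : ℝ) *
              ((2 * M + 1) * (Int.gcd (((a₁ * ℓ₁ : ℕ) : ℤ) - ((a₂ * ℓ₂ : ℕ) : ℤ)) (((b * (ℓ₁ * n₁)) : ℕ) : ℤ) : ℝ) / (((b * (ℓ₁ * n₁)) : ℕ) : ℝ) +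
                ((Nat.divisors ((b * (ℓ₁ * n₁)) / Int.gcd (((a₁ * ℓ₁ : ℕ) : ℤ) - ((a₂ * ℓ₂ : ℕ) : ℤ)) (((b * (ℓ₁ * n₁)) : ℕ) : ℤ))).card : ℝ) * Real.sqrt ((((b * (ℓ₁ * n₁)) / Int.gcd (((a₁ * ℓ₁ : ℕ) : ℤ) - ((a₂ * ℓ₂ : ℕ) : ℤ)) (((b * (ℓ₁ * n₁)) : ℕ) : ℤ)) : ℕ) : ℝ) *
                  (1 + Real.log ((((b * (ℓ₁ * n₁)) / Int.gcd (((a₁ * ℓ₁ : ℕ) : ℤ) - ((a₂ * ℓ₂ : ℕ) : ℤ)) (((b * (ℓ₁ * n₁)) : ℕ) : ℤ)) : ℕ) : ℝ))) *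
              (1 + 2 * Real.pi * (|η| * |((((a₁ * ℓ₁ : ℕ) : ℤ) - ((a₂ * ℓ₂ : ℕ) : ℤ)) : ℝ)| / (((b * (ℓ₁ * n₁)) : ℕ) : ℝ)) / M)) ≤ 2 * M := by
      rw [Finset.sum_congr rfl (g := fun _ => 2 * M) (fun a₂ ha₂ => by
        rw [if_pos (Finset.mem_filter.mp ha₂).2])]
      rw [Finset.sum_const, nsmul_eq_mul]
      have hcard := BC_diag_card_czero_le (ℓ₁ := ℓ₁) (a₁ := a₁) hℓ₂pos (Icc 1 ⌊2 * A⌋₊)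
      have hcard' : ((((Icc 1 ⌊2 * A⌋₊).filter (fun a₂ => (((a₁ * ℓ₁ : ℕ) : ℤ) - ((a₂ * ℓ₂ : ℕ) : ℤ)) = 0)).card : ℕ) : ℝ) ≤ 1 := by
        exact_mod_cast hcard
      calc ((((Icc 1 ⌊2 * A⌋₊).filter (fun a₂ => (((a₁ * ℓ₁ : ℕ) : ℤ) - ((a₂ * ℓ₂ : ℕ) : ℤ)) = 0)).card : ℕ) : ℝ) * (2 * M)
          ≤ 1 * (2 * M) := mul_le_mul_of_nonneg_right hcard' (by positivity)
        _ = 2 * M := one_mul _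
    -- the terms with `c ≠ 0`: pointwise bound, linear in `(c, q)`
    have hpt : ∀ a₂ ∈ (Icc 1 ⌊2 * A⌋₊).filter (fun a₂ => ¬ (((a₁ * ℓ₁ : ℕ) : ℤ) - ((a₂ * ℓ₂ : ℕ) : ℤ)) = 0),
        (if (((a₁ * ℓ₁ : ℕ) : ℤ) - ((a₂ * ℓ₂ : ℕ) : ℤ)) = 0 then 2 * M else
            ((Nat.divisors (b * (ℓ₁ * n₁))).card : ℝ) *
              ((2 * M + 1) * (Int.gcd (((a₁ * ℓ₁ : ℕ) : ℤ) - ((a₂ * ℓ₂ : ℕ) : ℤ)) (((b * (ℓ₁ * n₁)) : ℕ) : ℤ) : ℝ) / (((b * (ℓ₁ * n₁)) : ℕ) : ℝ) +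
                ((Nat.divisors ((b * (ℓ₁ * n₁)) / Int.gcd (((a₁ * ℓ₁ : ℕ) : ℤ) - ((a₂ * ℓ₂ : ℕ) : ℤ)) (((b * (ℓ₁ * n₁)) : ℕ) : ℤ))).card : ℝ) * Real.sqrt ((((b * (ℓ₁ * n₁)) / Int.gcd (((a₁ * ℓ₁ : ℕ) : ℤ) - ((a₂ * ℓ₂ : ℕ) : ℤ)) (((b * (ℓ₁ * n₁)) : ℕ) : ℤ)) : ℕ) : ℝ) *
                  (1 + Real.log ((((b * (ℓ₁ * n₁)) / Int.gcd (((a₁ * ℓ₁ : ℕ) : ℤ) - ((a₂ * ℓ₂ : ℕ) : ℤ)) (((b * (ℓ₁ * n₁)) : ℕ) : ℤ)) : ℕ) : ℝ))) *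
              (1 + 2 * Real.pi * (|η| * |((((a₁ * ℓ₁ : ℕ) : ℤ) - ((a₂ * ℓ₂ : ℕ) : ℤ)) : ℝ)| / (((b * (ℓ₁ * n₁)) : ℕ) : ℝ)) / M)) ≤
          2 * τ₀ * Tw * ((2 * M + 1) / ((((b * (ℓ₁ * n₁))) : ℕ) : ℝ)) * (Int.gcd (((a₁ * ℓ₁ : ℕ) : ℤ) - ((a₂ * ℓ₂ : ℕ) : ℤ)) (((b * (ℓ₁ * n₁)) : ℕ) : ℤ) : ℝ) +
            2 * τ₀ * Tw * (2 * τ₀ * (2 * SQ) * Lg) := by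
      intro a₂ ha₂
      obtain ⟨ha₂mem, hcne⟩ := Finset.mem_filter.mp ha₂
      have ha₂' : a₂ ≤ ⌊2 * A⌋₊ := (Finset.mem_Icc.mp ha₂mem).2
      rw [if_neg hcne]
      -- the pieces
      set g : ℕ := Int.gcd (((a₁ * ℓ₁ : ℕ) : ℤ) - ((a₂ * ℓ₂ : ℕ) : ℤ)) (((b * (ℓ₁ * n₁)) : ℕ) : ℤ) with hg
      have hg0 : 0 < g := by rw [hg]; exact Int.gcd_pos_of_ne_zero_left _ hcne
      have hgq : g ∣ (b * (ℓ₁ * n₁)) := by rw [hg]; exact_mod_cast Int.gcd_dvd_right (((a₁ * ℓ₁ : ℕ) : ℤ) - ((a₂ * ℓ₂ : ℕ) : ℤ)) ((((b * (ℓ₁ * n₁))) : ℕ) : ℤ)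
      have hq'q : (b * (ℓ₁ * n₁)) / g ∣ (b * (ℓ₁ * n₁)) := Nat.div_dvd_of_dvd hgq
      have hq'0 : 0 < (b * (ℓ₁ * n₁)) / g := Nat.div_pos (Nat.le_of_dvd hq0 hgq) hg0
      have hτq' : ((Nat.divisors ((b * (ℓ₁ * n₁)) / g)).card : ℝ) ≤ 2 * τ₀ := by
        have h1 : ((Nat.divisors ((b * (ℓ₁ * n₁)) / g)).card : ℝ) ≤ (Nat.divisors (b * (ℓ₁ * n₁))).card := by
          exact_mod_cast Finset.card_le_card (Nat.divisors_subset_of_dvd hq0.ne' hq'q)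
        exact h1.trans hτq
      have hsq : Real.sqrt ((((b * (ℓ₁ * n₁)) / g : ℕ)) : ℝ) ≤ 2 * SQ := by
        have h1 : ((((b * (ℓ₁ * n₁)) / g : ℕ)) : ℝ) ≤ ((((b * (ℓ₁ * n₁))) : ℕ) : ℝ) := by
          exact_mod_cast Nat.div_le_self _ _
        calc Real.sqrt ((((b * (ℓ₁ * n₁)) / g : ℕ)) : ℝ) ≤ Real.sqrt (4 * ((b : ℝ) * L * N')) :=
              Real.sqrt_le_sqrt (h1.trans hq_ub)
          _ = 2 * SQ := by
              rw [hSQ, Real.sqrt_mul (by norm_num : (0:ℝ) ≤ 4), show Real.sqrt (4 : ℝ) = 2 by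
                rw [show (4 : ℝ) = 2 ^ 2 by norm_num, Real.sqrt_sq (by norm_num)]]
      have hlg : 1 + Real.log ((((b * (ℓ₁ * n₁)) / g : ℕ)) : ℝ) ≤ Lg := by
        rw [hLg]
        have h1 := BC_diag_qred_le (a₁ := a₁) (a₂ := a₂) hb hℓ₁p hℓ₂p hℓ₁L hLℓ₂ hn₁pos hn₁N
          hℓ₂dvd hcne
        have h0 : (0 : ℝ) < ((((b * (ℓ₁ * n₁)) / g : ℕ)) : ℝ) := by exact_mod_cast hq'0
        have := Real.log_le_log h0 h1
        linarith
      have hlg0 : 0 ≤ 1 + Real.log ((((b * (ℓ₁ * n₁)) / g : ℕ)) : ℝ) := by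
        have : (1 : ℝ) ≤ ((((b * (ℓ₁ * n₁)) / g : ℕ)) : ℝ) := by exact_mod_cast hq'0
        have := Real.log_nonneg this
        linarith
      have htw : 1 + 2 * Real.pi * (|η| * |(((((a₁ * ℓ₁ : ℕ) : ℤ) - ((a₂ * ℓ₂ : ℕ) : ℤ))) : ℝ)| / ((((b * (ℓ₁ * n₁))) : ℕ) : ℝ)) / M ≤ Tw := by
        rw [hTw]
        have hc_abs : |(((((a₁ * ℓ₁ : ℕ) : ℤ) - ((a₂ * ℓ₂ : ℕ) : ℤ))) : ℝ)| ≤ 4 * A * L := by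
          have h1 : a₁ * ℓ₁ ≤ ⌊2 * A⌋₊ * (2 * L) := Nat.mul_le_mul ha₁' hℓ₁L
          have h2 : a₂ * ℓ₂ ≤ ⌊2 * A⌋₊ * (2 * L) := Nat.mul_le_mul ha₂' hℓ₂L
          have h1r : (((a₁ * ℓ₁ : ℕ) : ℤ) : ℝ) ≤ ((⌊2 * A⌋₊ : ℕ) : ℝ) * (2 * L) := by
            have : (((a₁ * ℓ₁ : ℕ) : ℤ) : ℝ) = ((a₁ * ℓ₁ : ℕ) : ℝ) := by norm_cast
            rw [this]; exact_mod_cast h1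
          have h2r : (((a₂ * ℓ₂ : ℕ) : ℤ) : ℝ) ≤ ((⌊2 * A⌋₊ : ℕ) : ℝ) * (2 * L) := by
            have : (((a₂ * ℓ₂ : ℕ) : ℤ) : ℝ) = ((a₂ * ℓ₂ : ℕ) : ℝ) := by norm_cast
            rw [this]; exact_mod_cast h2
          have h1p : (0 : ℝ) ≤ (((a₁ * ℓ₁ : ℕ) : ℤ) : ℝ) := by positivity
          have h2p : (0 : ℝ) ≤ (((a₂ * ℓ₂ : ℕ) : ℤ) : ℝ) := by positivity
          have hfl : ((⌊2 * A⌋₊ : ℕ) : ℝ) * (2 * L) ≤ 4 * A * L := by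
            calc ((⌊2 * A⌋₊ : ℕ) : ℝ) * (2 * L) ≤ (2 * A) * (2 * L) :=
                  mul_le_mul_of_nonneg_right hfloorA (by positivity)
              _ = 4 * A * L := by ring
          rw [abs_le]
          exact ⟨by linarith only [h2r, hfl, h1p], by linarith only [h1r, hfl, h2p]⟩
        have hratio : |η| * |(((((a₁ * ℓ₁ : ℕ) : ℤ) - ((a₂ * ℓ₂ : ℕ) : ℤ))) : ℝ)| / ((((b * (ℓ₁ * n₁))) : ℕ) : ℝ) ≤ |η| * (4 * A / ((b : ℝ) * N')) := by
          rw [mul_div_assoc]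
          apply mul_le_mul_of_nonneg_left _ (abs_nonneg _)
          have hL0 : (L : ℝ) ≠ 0 := by positivity
          calc |(((((a₁ * ℓ₁ : ℕ) : ℤ) - ((a₂ * ℓ₂ : ℕ) : ℤ))) : ℝ)| / ((((b * (ℓ₁ * n₁))) : ℕ) : ℝ) ≤ (4 * A * L) / ((((b * (ℓ₁ * n₁))) : ℕ) : ℝ) :=
                div_le_div_of_nonneg_right hc_abs hqpos.le
            _ ≤ (4 * A * L) / ((b : ℝ) * L * N') :=
                div_le_div_of_nonneg_left (by positivity) hbLN hq_lb.le
            _ = 4 * A / ((b : ℝ) * N') := by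
                field_simp
        have : 2 * Real.pi * (|η| * |(((((a₁ * ℓ₁ : ℕ) : ℤ) - ((a₂ * ℓ₂ : ℕ) : ℤ))) : ℝ)| / ((((b * (ℓ₁ * n₁))) : ℕ) : ℝ)) / M ≤
            2 * Real.pi * (|η| * (4 * A / ((b : ℝ) * N'))) / M := by
          apply div_le_div_of_nonneg_right _ hM0.le
          exact mul_le_mul_of_nonneg_left hratio (by positivity)
        linarith only [this]
      have htw0 : 0 ≤ 1 + 2 * Real.pi * (|η| * |(((((a₁ * ℓ₁ : ℕ) : ℤ) - ((a₂ * ℓ₂ : ℕ) : ℤ))) : ℝ)| / ((((b * (ℓ₁ * n₁))) : ℕ) : ℝ)) / M := by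
        positivity
      -- assemble the pointwise bound
      have hT2 : ((Nat.divisors ((b * (ℓ₁ * n₁)) / g)).card : ℝ) * Real.sqrt ((((b * (ℓ₁ * n₁)) / g : ℕ)) : ℝ) *
          (1 + Real.log ((((b * (ℓ₁ * n₁)) / g : ℕ)) : ℝ)) ≤ 2 * τ₀ * (2 * SQ) * Lg := by
        apply mul_le_mul (mul_le_mul hτq' hsq (Real.sqrt_nonneg _) (by positivity)) hlg hlg0
          (by positivity)
      have hT1 : (2 * M + 1) * (g : ℝ) / ((((b * (ℓ₁ * n₁))) : ℕ) : ℝ) =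
          ((2 * M + 1) / ((((b * (ℓ₁ * n₁))) : ℕ) : ℝ)) * (g : ℝ) := by ring
      have hgR : 0 ≤ (g : ℝ) := Nat.cast_nonneg _
      have hsum0 : 0 ≤ (2 * M + 1) * (g : ℝ) / ((((b * (ℓ₁ * n₁))) : ℕ) : ℝ) +
          ((Nat.divisors ((b * (ℓ₁ * n₁)) / g)).card : ℝ) * Real.sqrt ((((b * (ℓ₁ * n₁)) / g : ℕ)) : ℝ) *
            (1 + Real.log ((((b * (ℓ₁ * n₁)) / g : ℕ)) : ℝ)) := by positivity
      calc ((Nat.divisors (b * (ℓ₁ * n₁))).card : ℝ) *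
            ((2 * M + 1) * (g : ℝ) / ((((b * (ℓ₁ * n₁))) : ℕ) : ℝ) +
              ((Nat.divisors ((b * (ℓ₁ * n₁)) / g)).card : ℝ) * Real.sqrt ((((b * (ℓ₁ * n₁)) / g : ℕ)) : ℝ) *
                (1 + Real.log ((((b * (ℓ₁ * n₁)) / g : ℕ)) : ℝ))) *
            (1 + 2 * Real.pi * (|η| * |(((((a₁ * ℓ₁ : ℕ) : ℤ) - ((a₂ * ℓ₂ : ℕ) : ℤ))) : ℝ)| / ((((b * (ℓ₁ * n₁))) : ℕ) : ℝ)) / M)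
          ≤ (2 * τ₀) * (((2 * M + 1) / ((((b * (ℓ₁ * n₁))) : ℕ) : ℝ)) * (g : ℝ) + 2 * τ₀ * (2 * SQ) * Lg) * Tw := by
            apply mul_le_mul _ htw htw0 (by positivity)
            rw [← hT1]
            exact mul_le_mul hτq (add_le_add le_rfl hT2) hsum0 (by positivity)
        _ = 2 * τ₀ * Tw * ((2 * M + 1) / ((((b * (ℓ₁ * n₁))) : ℕ) : ℝ)) * (g : ℝ) +
            2 * τ₀ * Tw * (2 * τ₀ * (2 * SQ) * Lg) := by ring
    have hnz : ∑ a₂ ∈ (Icc 1 ⌊2 * A⌋₊).filter (fun a₂ => ¬ (((a₁ * ℓ₁ : ℕ) : ℤ) - ((a₂ * ℓ₂ : ℕ) : ℤ)) = 0),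
        (if (((a₁ * ℓ₁ : ℕ) : ℤ) - ((a₂ * ℓ₂ : ℕ) : ℤ)) = 0 then 2 * M else
            ((Nat.divisors (b * (ℓ₁ * n₁))).card : ℝ) *
              ((2 * M + 1) * (Int.gcd (((a₁ * ℓ₁ : ℕ) : ℤ) - ((a₂ * ℓ₂ : ℕ) : ℤ)) (((b * (ℓ₁ * n₁)) : ℕ) : ℤ) : ℝ) / (((b * (ℓ₁ * n₁)) : ℕ) : ℝ) +
                ((Nat.divisors ((b * (ℓ₁ * n₁)) / Int.gcd (((a₁ * ℓ₁ : ℕ) : ℤ) - ((a₂ * ℓ₂ : ℕ) : ℤ)) (((b * (ℓ₁ * n₁)) : ℕ) : ℤ))).card : ℝ) * Real.sqrt ((((b * (ℓ₁ * n₁)) / Int.gcd (((a₁ * ℓ₁ : ℕ) : ℤ) - ((a₂ * ℓ₂ : ℕ) : ℤ)) (((b * (ℓ₁ * n₁)) : ℕ) : ℤ)) : ℕ) : ℝ) *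
                  (1 + Real.log ((((b * (ℓ₁ * n₁)) / Int.gcd (((a₁ * ℓ₁ : ℕ) : ℤ) - ((a₂ * ℓ₂ : ℕ) : ℤ)) (((b * (ℓ₁ * n₁)) : ℕ) : ℤ)) : ℕ) : ℝ))) *
              (1 + 2 * Real.pi * (|η| * |((((a₁ * ℓ₁ : ℕ) : ℤ) - ((a₂ * ℓ₂ : ℕ) : ℤ)) : ℝ)| / (((b * (ℓ₁ * n₁)) : ℕ) : ℝ)) / M)) ≤
          τ₀ ^ 2 * Tw * (32 * (2 * M + 1) * A / ((b : ℝ) * N') + 16 * A * SQ * Lg) := by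
      refine (Finset.sum_le_sum hpt).trans ?_
      rw [Finset.sum_add_distrib, ← Finset.mul_sum, Finset.sum_const, nsmul_eq_mul]
      -- the gcd sum and the number of terms
      have hgcd := BC_diag_gcd_sum_le (n₁ := n₁) (a₁ := a₁) (A := A) hq0 hℓ₁L hℓ₂L hℓ₂pos ha₁'
      have hgcd' : ∑ a₂ ∈ (Icc 1 ⌊2 * A⌋₊).filter (fun a₂ => ¬ (((a₁ * ℓ₁ : ℕ) : ℤ) - ((a₂ * ℓ₂ : ℕ) : ℤ)) = 0), (Int.gcd (((a₁ * ℓ₁ : ℕ) : ℤ) - ((a₂ * ℓ₂ : ℕ) : ℤ)) (((b * (ℓ₁ * n₁)) : ℕ) : ℤ) : ℝ) ≤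
          2 * (2 * τ₀) * (4 * A * L) := by
        refine hgcd.trans ?_
        have hN0 : ((2 * L * ⌊2 * A⌋₊ : ℕ) : ℝ) ≤ 4 * A * L := by
          push_cast
          calc 2 * (L : ℝ) * ((⌊2 * A⌋₊ : ℕ) : ℝ) ≤ 2 * (L : ℝ) * (2 * A) :=
                mul_le_mul_of_nonneg_left hfloorA (by positivity)
            _ = 4 * A * L := by ring
        have hτq0 : (0 : ℝ) ≤ (Nat.divisors (b * (ℓ₁ * n₁))).card := Nat.cast_nonneg _
        calc 2 * ((Nat.divisors (b * (ℓ₁ * n₁))).card : ℝ) * ((2 * L * ⌊2 * A⌋₊ : ℕ) : ℝ)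
            ≤ 2 * (2 * τ₀) * ((2 * L * ⌊2 * A⌋₊ : ℕ) : ℝ) := by
              apply mul_le_mul_of_nonneg_right _ (Nat.cast_nonneg _)
              linarith only [hτq]
          _ ≤ 2 * (2 * τ₀) * (4 * A * L) := by
              apply mul_le_mul_of_nonneg_left hN0 (by positivity)
      have hcardS : ((((Icc 1 ⌊2 * A⌋₊).filter (fun a₂ => ¬ (((a₁ * ℓ₁ : ℕ) : ℤ) - ((a₂ * ℓ₂ : ℕ) : ℤ)) = 0)).card : ℕ) : ℝ) ≤ 2 * A := by
        calc ((((Icc 1 ⌊2 * A⌋₊).filter (fun a₂ => ¬ (((a₁ * ℓ₁ : ℕ) : ℤ) - ((a₂ * ℓ₂ : ℕ) : ℤ)) = 0)).card : ℕ) : ℝ)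
            ≤ ((Icc 1 ⌊2 * A⌋₊).card : ℝ) := by exact_mod_cast Finset.card_filter_le _ _
          _ = ((⌊2 * A⌋₊ : ℕ) : ℝ) := by simp
          _ ≤ 2 * A := hfloorA
      have hK1 : 0 ≤ 2 * τ₀ * Tw * ((2 * M + 1) / ((((b * (ℓ₁ * n₁))) : ℕ) : ℝ)) := by positivity
      have hK2 : 0 ≤ 2 * τ₀ * Tw * (2 * τ₀ * (2 * SQ) * Lg) := by positivity
      have hinvq : (2 * M + 1) / ((((b * (ℓ₁ * n₁))) : ℕ) : ℝ) ≤ (2 * M + 1) / ((b : ℝ) * L * N') :=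
        div_le_div_of_nonneg_left (by positivity) hbLN hq_lb.le
      calc 2 * τ₀ * Tw * ((2 * M + 1) / ((((b * (ℓ₁ * n₁))) : ℕ) : ℝ)) *
              ∑ a₂ ∈ (Icc 1 ⌊2 * A⌋₊).filter (fun a₂ => ¬ (((a₁ * ℓ₁ : ℕ) : ℤ) - ((a₂ * ℓ₂ : ℕ) : ℤ)) = 0), (Int.gcd (((a₁ * ℓ₁ : ℕ) : ℤ) - ((a₂ * ℓ₂ : ℕ) : ℤ)) (((b * (ℓ₁ * n₁)) : ℕ) : ℤ) : ℝ) +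
            ((((Icc 1 ⌊2 * A⌋₊).filter (fun a₂ => ¬ (((a₁ * ℓ₁ : ℕ) : ℤ) - ((a₂ * ℓ₂ : ℕ) : ℤ)) = 0)).card : ℕ) : ℝ) *
              (2 * τ₀ * Tw * (2 * τ₀ * (2 * SQ) * Lg))
          ≤ 2 * τ₀ * Tw * ((2 * M + 1) / ((b : ℝ) * L * N')) * (2 * (2 * τ₀) * (4 * A * L)) +
            (2 * A) * (2 * τ₀ * Tw * (2 * τ₀ * (2 * SQ) * Lg)) := by
            apply add_le_add
            · apply mul_le_mul _ hgcd' (Finset.sum_nonneg fun _ _ => Nat.cast_nonneg _) (by positivity)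
              exact mul_le_mul_of_nonneg_left hinvq (by positivity)
            · exact mul_le_mul_of_nonneg_right hcardS hK2
        _ = τ₀ ^ 2 * Tw * (32 * (2 * M + 1) * A / ((b : ℝ) * N') + 16 * A * SQ * Lg) := by
            field_simp
            ring
    rw [hI₀]
    exact add_le_add hzero hnz
  -- sum over `ℓ₂`
  have hcard : (((((Ioc L (2 * L)).filter (fun ℓ => ℓ.Prime ∧ ℓ.Coprime b ∧ ℓ.Coprime ϑ.natAbs)).filter (fun ℓ₂ => ℓ₂ ∣ ℓ₁ * n₁)).card : ℕ) : ℝ) ≤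
      1 + ((Nat.divisors n₁).card : ℝ) := by
    have h := BC_card_amp_dvd_le ((Ioc L (2 * L)).filter (fun ℓ => ℓ.Prime ∧ ℓ.Coprime b ∧ ℓ.Coprime ϑ.natAbs)) (fun ℓ hℓ => (Finset.mem_filter.mp hℓ).2.1) hℓ₁p hn₁pos
    exact_mod_cast h
  calc _ ≤ ∑ ℓ₂ ∈ ((Ioc L (2 * L)).filter (fun ℓ => ℓ.Prime ∧ ℓ.Coprime b ∧ ℓ.Coprime ϑ.natAbs)).filter (fun ℓ₂ => ℓ₂ ∣ ℓ₁ * n₁), I₀ := Finset.sum_le_sum hper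
    _ = (((((Ioc L (2 * L)).filter (fun ℓ => ℓ.Prime ∧ ℓ.Coprime b ∧ ℓ.Coprime ϑ.natAbs)).filter (fun ℓ₂ => ℓ₂ ∣ ℓ₁ * n₁)).card : ℕ) : ℝ) * I₀ := by
        rw [Finset.sum_const, nsmul_eq_mul]
    _ ≤ (1 + ((Nat.divisors n₁).card : ℝ)) * I₀ := mul_le_mul_of_nonneg_right hcard hI₀0

end Literature.NumberTheory.LFunctions

end
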